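import Summits.CriticalPhenomena.PercolationContinuityZ3.Theorems.Transplant.SkelPhiStepINegDefs
import Summits.CriticalPhenomena.PercolationContinuityZ3.Theorems.Transplant.SkelPhiOrientation
import HarnessLib

/-!
# N1 params over the ORIENTED Step-I″ output `(D, DT, ori)` ((L0-5), p3-g8 2026-08-21T14:10Z): THE MERGED RECORD `DataN.orient D DT ori` and THE ORIENTED MAP `oriφ φ b`
# — so that the nine landed params files (`SkelNegParamsScales/Coarse/Lattice/LatticeInv/FineMult`, `SkelNeg1ParamsKit/P/O/L`) apply VERBATIM at `D := orient D DT ori`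

builds on p205010 (kernel theorem, internal audit signed; external expert review pending) — nothing in this file uses p205010; NOTHING is claimed about
the node `SamePDropOfSkeletonNeg₁` (OPEN).
Status sentence (coordinator 2026-08-20T04:30Z): "θ(p_c) = 0 on ℤ^d, all d ≥ 2 — kernel-verified (Lean 4/Mathlib, standard axioms); internal adversarial
audit SIGNED 2026-08-20 04:29Z; external expert review pending."
Lane `prim-bschramm-*`, seat `prim-bschramm-stmt` (gen 13); helper file (`--supports stmt-CriticalPhenomena-4575 --as helper`); ledger HOME/prim-bschramm-stmt/NEG-PARAMS.md v0.8 (κ-ruling).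
WHY: the record of record for LEVEL 1 is p3-g8's `exists_stepI_negO` — TWO Step-I″ records `D` (for `φ`) and `DT` (for the transpose `trφ φ`) sharing `Λ, k, R, M₀, n₁`, and an
orientation bit `ori t M n` saying which one carries the geometric clause (with `|h| ≤ 10·n`) at the admissible pair `(M, n)`.  The ledger's values (zone scale, short
pair, kit block, long box `M_L`, long width `n_L`, long data, cells, lists) are all functions of ONE `DataN`; evaluating them at the MERGED record
`orient D DT ori` (shared fields from `D`; `hgt/len/spl` at `(t, M, n)` read from `D` if `ori t M n` else from `DT`) gives the orientation-correct values with no re-typing, and the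
only oriented OBJECTS are the planar maps at the two pairs, `oriφ φ (ori t M n) = φ` or `trφ φ`.
* §1 **`Skelφ.oriφ φ b`** (`bif b then φ else trφ φ`), `oriφ_true/false`, `lip_oriφ`, `steps_oriφ`, `cyl_oriφ`;
* §2 **`Skelφ.StepI.DataN.orient D DT ori`**, the field lemmas (`orient_Λ/k/R/M₀/n₁` by `rfl`, `orient_hgt/len/spl_of_eq_true/false`, `orient_scale_…`), the congruence
  `DataN.eqGeom_congr` (`EqGeom` at `(t, M, n)` depends only on `R` and the three data AT `(t, M, n)`), the transfers **`eqGeom_orient_true`** / **`eqGeom_orient_false`**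
  (`(orient D DT ori).EqGeom G ψ t M n ↔ D.EqGeom G ψ t M n` resp. `↔ DT.EqGeom G ψ t M n`, the latter under `DT.R = D.R`), the input events `eventN_orient_none` (zones are
  orientation-free), `eventN_orient_some_true/false`, and the PACKAGE **`orient_clause`**: from the two implications of `FactsO` at `(t, M, n)`,
  `(orient D DT ori).EqGeom G (oriφ φ (ori t M n)) t M n ∧ |(orient D DT ori).hgt t M n| ≤ 10·n`.
[cite: MartineauTassion2017, §3.2 Lemma 3.5 (the equilibrium; no control of the shear)] [cite: KozmaNitzan2024, §4 Theorem 6 (pp. 25–31): the order of constants]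
-/

noncomputable section

namespace Summit.CriticalPhenomena.PercolationContinuityZ3.Theorems.Transplant

namespace Skelφ

open Literature.Probability.Percolation Literature.Probability.LatticeModels SimpleGraph
open scoped Classical

variable {V : Type} {G : SimpleGraph V}

/-! ## §1 The oriented planar map -/

/-- **The oriented skeleton map**: `φ` itself when the bit is `true`, its transpose `trφ φ = (φ₁, φ₀)` when `false`. [this work] -/
def oriφ (φ : V → Site 2) (b : Bool) : V → Site 2 := bif b then φ else trφ φ

/-- `oriφ φ true = φ`. [folklore] -/
@[simp] theorem oriφ_true (φ : V → Site 2) : oriφ φ true = φ := rfl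

/-- `oriφ φ false = trφ φ`. [folklore] -/
@[simp] theorem oriφ_false (φ : V → Site 2) : oriφ φ false = trφ φ := rfl

/-- `oriφ` as an `if`. [folklore] -/
theorem oriφ_eq_ite (φ : V → Site 2) (b : Bool) : oriφ φ b = if b = true then φ else trφ φ := by cases b <;> rfl

/-- **The oriented map is 1-Lipschitz** (both orientations are). [folklore] -/
theorem lip_oriφ {φ : V → Site 2} (h : Lip G φ) (b : Bool) : Lip G (oriφ φ b) := by
  cases b
  · exact lip_trφ h
  · exact h

/-- **The oriented map has unit steps** (both orientations have). [folklore] -/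
theorem steps_oriφ {φ : V → Site 2} (h : Steps G φ) (b : Bool) : Steps G (oriφ φ b) := by
  cases b
  · exact steps_trφ h
  · exact h

/-- Cylinders are orientation-free. [folklore] -/
theorem cyl_oriφ (φ : V → Site 2) (b : Bool) (t : V) (ℓ : ℕ) : cyl (oriφ φ b) t ℓ = cyl φ t ℓ := by
  cases b
  · exact cyl_trφ φ t ℓ
  · rfl

/-! ## §2 The merged record -/

namespace StepI

/-- **THE MERGED STEP-I″ RECORD** of the oriented output `(D, DT, ori)`: the shared fields `Λ, k, R, M₀, n₁` from `D`, and at every `(t, M, n)` the equilibrium data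
`(h, ℓ, v)` of the record the orientation bit selects (`D` if `ori t M n`, else `DT`).  Every params value of the ledger evaluated at this record is the value of the
chosen orientation. [this work] -/
def DataN.orient (D DT : DataN V) (ori : V → ℕ → ℕ → Bool) : DataN V where
  Λ := D.Λ
  k := D.k
  R := D.R
  M₀ := D.M₀
  n₁ := D.n₁
  hgt := fun t M n => if ori t M n = true then D.hgt t M n else DT.hgt t M n
  len := fun t M n => if ori t M n = true then D.len t M n else DT.len t M n
  spl := fun t M n => if ori t M n = true then D.spl t M n else DT.spl t M n

section Fields

variable (D DT : DataN V) (ori : V → ℕ → ℕ → Bool)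

/-- Shared field `Λ`. [folklore] -/
@[simp] theorem orient_Λ : (D.orient DT ori).Λ = D.Λ := rfl

/-- Shared field `k`. [folklore] -/
@[simp] theorem orient_k : (D.orient DT ori).k = D.k := rfl

/-- Shared field `R`. [folklore] -/
@[simp] theorem orient_R : (D.orient DT ori).R = D.R := rfl

/-- Shared field `M₀`. [folklore] -/
@[simp] theorem orient_M₀ : (D.orient DT ori).M₀ = D.M₀ := rfl

/-- Shared field `n₁`. [folklore] -/
@[simp] theorem orient_n₁ : (D.orient DT ori).n₁ = D.n₁ := rfl

variable {D DT ori}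

/-- **The data at a `true` pair are `D`'s.** [folklore] -/
theorem orient_data_of_eq_true {t : V} {M n : ℕ} (h : ori t M n = true) :
    (D.orient DT ori).hgt t M n = D.hgt t M n ∧ (D.orient DT ori).len t M n = D.len t M n ∧ (D.orient DT ori).spl t M n = D.spl t M n := by
  simp [DataN.orient, h]

/-- **The data at a `false` pair are `DT`'s.** [folklore] -/
theorem orient_data_of_eq_false {t : V} {M n : ℕ} (h : ori t M n = false) :
    (D.orient DT ori).hgt t M n = DT.hgt t M n ∧ (D.orient DT ori).len t M n = DT.len t M n ∧ (D.orient DT ori).spl t M n = DT.spl t M n := by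
  simp [DataN.orient, h]

/-- The link-region scale at a `true` pair. [folklore] -/
theorem orient_scale_of_eq_true {t : V} {M n : ℕ} (h : ori t M n = true) : (D.orient DT ori).scale t M n = D.scale t M n := by
  obtain ⟨h1, h2, -⟩ := orient_data_of_eq_true (D := D) (DT := DT) h
  unfold DataN.scale; rw [h1, h2]

/-- The link-region scale at a `false` pair. [folklore] -/
theorem orient_scale_of_eq_false {t : V} {M n : ℕ} (h : ori t M n = false) : (D.orient DT ori).scale t M n = DT.scale t M n := by
  obtain ⟨h1, h2, -⟩ := orient_data_of_eq_false (D := D) (DT := DT) h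
  unfold DataN.scale; rw [h1, h2]

end Fields

/-! ### The geometric clause and the input events through the merge -/

section Transfer

variable [G.LocallyFinite]

/-- **Congruence of the geometric clause**: `EqGeom` at `(t, M, n)` depends on the record only through `R` and the three data AT `(t, M, n)`. [folklore] -/
theorem DataN.eqGeom_congr {D D' : DataN V} {t : V} {M n : ℕ} (hR : D'.R = D.R) (hh : D'.hgt t M n = D.hgt t M n) (hl : D'.len t M n = D.len t M n)
    (hs : D'.spl t M n = D.spl t M n) (ψ : V → Site 2) : D'.EqGeom G ψ t M n ↔ D.EqGeom G ψ t M n := by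
  have hp : ∀ (fam : Fin 2) (σ τ : ℤˣ), pieceN G ψ D' t M n fam σ τ = pieceN G ψ D t M n fam σ τ := by
    intro fam σ τ
    unfold pieceN DataN.scale
    rw [hR, hh, hl, hs]
  unfold DataN.EqGeom
  simp only [hh, hl, hs, hp]

omit [G.LocallyFinite] in
/-- Congruence of the link region. [folklore] -/
theorem regionN_congr {D D' : DataN V} {t : V} {M n : ℕ} (hR : D'.R = D.R) (hh : D'.hgt t M n = D.hgt t M n) (hl : D'.len t M n = D.len t M n)
    (ψ : V → Site 2) : regionN G ψ D' t M n = regionN G ψ D t M n := by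
  unfold regionN DataN.scale; rw [hR, hh, hl]

/-- Congruence of the pieces. [folklore] -/
theorem pieceN_congr {D D' : DataN V} {t : V} {M n : ℕ} (hR : D'.R = D.R) (hh : D'.hgt t M n = D.hgt t M n) (hl : D'.len t M n = D.len t M n)
    (hs : D'.spl t M n = D.spl t M n) (ψ : V → Site 2) (fam : Fin 2) (σ τ : ℤˣ) : pieceN G ψ D' t M n fam σ τ = pieceN G ψ D t M n fam σ τ := by
  unfold pieceN DataN.scale; rw [hR, hh, hl, hs]

/-- Congruence of the piece-link input events: they depend on the record only through `Λ t k`, `R` and the three data AT `(t, M, n)`. [folklore] -/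
theorem eventN_some_congr {D D' : DataN V} {t : V} {M n : ℕ} (hΛk : D'.Λ t D'.k = D.Λ t D.k) (hR : D'.R = D.R) (hh : D'.hgt t M n = D.hgt t M n)
    (hl : D'.len t M n = D.len t M n) (hs : D'.spl t M n = D.spl t M n) (ψ : V → Site 2) (fam : Fin 2) (σ τ : ℤˣ) :
    eventN G ψ D' (t, M, some (n, fam, σ, τ)) = eventN G ψ D (t, M, some (n, fam, σ, τ)) := by
  rw [eventN_some, eventN_some, regionN_congr hR hh hl ψ, pieceN_congr hR hh hl hs ψ, hΛk]

variable {D DT : DataN V} {ori : V → ℕ → ℕ → Bool}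

/-- **TRANSFER, `true` pair**: the merged record's geometric clause at `(t, M, n)` is `D`'s (for any map `ψ`). [this work] -/
theorem eqGeom_orient_true {t : V} {M n : ℕ} (h : ori t M n = true) (ψ : V → Site 2) :
    (D.orient DT ori).EqGeom G ψ t M n ↔ D.EqGeom G ψ t M n := by
  obtain ⟨h1, h2, h3⟩ := orient_data_of_eq_true (D := D) (DT := DT) h
  exact DataN.eqGeom_congr (D := D) (D' := D.orient DT ori) rfl h1 h2 h3 ψ

/-- **TRANSFER, `false` pair**: the merged record's geometric clause at `(t, M, n)` is `DT`'s (for any map `ψ`; shared radius `DT.R = D.R`). [this work] -/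
theorem eqGeom_orient_false {t : V} {M n : ℕ} (h : ori t M n = false) (hR : DT.R = D.R) (ψ : V → Site 2) :
    (D.orient DT ori).EqGeom G ψ t M n ↔ DT.EqGeom G ψ t M n := by
  obtain ⟨h1, h2, h3⟩ := orient_data_of_eq_false (D := D) (DT := DT) h
  have hR' : (D.orient DT ori).R = DT.R := hR.symm
  exact DataN.eqGeom_congr (D := DT) (D' := D.orient DT ori) hR' h1 h2 h3 ψ

/-- **Zone inputs are orientation-free**: the merged record's zone event is `D`'s (any map). [folklore] -/
theorem eventN_orient_none (ψ : V → Site 2) (t : V) (M : ℕ) : eventN G ψ (D.orient DT ori) (t, M, none) = eventN G ψ D (t, M, none) := rfl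

/-- **Piece-link inputs, `true` pair**: the merged record's event is `D`'s. [folklore] -/
theorem eventN_orient_some_true {t : V} {M n : ℕ} (h : ori t M n = true) (ψ : V → Site 2) (fam : Fin 2) (σ τ : ℤˣ) :
    eventN G ψ (D.orient DT ori) (t, M, some (n, fam, σ, τ)) = eventN G ψ D (t, M, some (n, fam, σ, τ)) := by
  obtain ⟨h1, h2, h3⟩ := orient_data_of_eq_true (D := D) (DT := DT) h
  exact eventN_some_congr (D := D) (D' := D.orient DT ori) rfl rfl h1 h2 h3 ψ fam σ τ

/-- **Piece-link inputs, `false` pair**: the merged record's event is `DT`'s (shared `Λ`, `k`, `R`). [folklore] -/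
theorem eventN_orient_some_false {t : V} {M n : ℕ} (h : ori t M n = false) (hΛ : DT.Λ = D.Λ) (hk : DT.k = D.k) (hR : DT.R = D.R) (ψ : V → Site 2)
    (fam : Fin 2) (σ τ : ℤˣ) :
    eventN G ψ (D.orient DT ori) (t, M, some (n, fam, σ, τ)) = eventN G ψ DT (t, M, some (n, fam, σ, τ)) := by
  obtain ⟨h1, h2, h3⟩ := orient_data_of_eq_false (D := D) (DT := DT) h
  have hR' : (D.orient DT ori).R = DT.R := hR.symm
  have hΛk : (D.orient DT ori).Λ t (D.orient DT ori).k = DT.Λ t DT.k := by simp only [orient_Λ, orient_k, hΛ, hk]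
  exact eventN_some_congr (D := DT) (D' := D.orient DT ori) hΛk hR' h1 h2 h3 ψ fam σ τ

/-- **THE ORIENTED CLAUSE, PACKAGED**: from the two implications Step I″-O hands at an admissible `(t, M, n)` (`FactsO`), the merged record satisfies the geometric
clause FOR THE ORIENTED MAP `oriφ φ (ori t M n)` and the shear bound `|h| ≤ 10·n` — one statement, both orientations. [this work] -/
theorem orient_clause {φ : V → Site 2} {t : V} {M n : ℕ} (hR : DT.R = D.R)
    (htrue : ori t M n = true → D.EqGeom G φ t M n ∧ (D.hgt t M n).natAbs ≤ 10 * n)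
    (hfalse : ori t M n = false → DT.EqGeom G (trφ φ) t M n ∧ (DT.hgt t M n).natAbs ≤ 10 * n) :
    (D.orient DT ori).EqGeom G (oriφ φ (ori t M n)) t M n ∧ ((D.orient DT ori).hgt t M n).natAbs ≤ 10 * n := by
  cases hb : ori t M n
  · obtain ⟨hE, hκ⟩ := hfalse hb
    refine ⟨?_, ?_⟩
    · rw [oriφ_false, eqGeom_orient_false hb hR]; exact hE
    · rw [(orient_data_of_eq_false (D := D) (DT := DT) hb).1]; exact hκ
  · obtain ⟨hE, hκ⟩ := htrue hb
    refine ⟨?_, ?_⟩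
    · rw [oriφ_true, eqGeom_orient_true hb]; exact hE
    · rw [(orient_data_of_eq_true (D := D) (DT := DT) hb).1]; exact hκ

/-- **The oriented clause at every admissible pair** (the `∀ M ≥ M₀, ∀ n ≥ n₁ M` form of `FactsO`'s last conjunct, merged). [this work] -/
theorem orient_clause_all {φ : V → Site 2} {t : V} (hR : DT.R = D.R)
    (hfacts : ∀ M, D.M₀ ≤ M → ∀ n, D.n₁ M ≤ n →
      (ori t M n = true → D.EqGeom G φ t M n ∧ (D.hgt t M n).natAbs ≤ 10 * n) ∧
      (ori t M n = false → DT.EqGeom G (trφ φ) t M n ∧ (DT.hgt t M n).natAbs ≤ 10 * n)) :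
    ∀ M, (D.orient DT ori).M₀ ≤ M → ∀ n, (D.orient DT ori).n₁ M ≤ n →
      (D.orient DT ori).EqGeom G (oriφ φ (ori t M n)) t M n ∧ ((D.orient DT ori).hgt t M n).natAbs ≤ 10 * n := by
  intro M hM n hn
  exact orient_clause hR (hfacts M hM n hn).1 (hfacts M hM n hn).2

end Transfer

end StepI

end Skelφ

end Summit.CriticalPhenomena.PercolationContinuityZ3.Theorems.Transplant

end
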